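import Literature.NumberTheory.EllipticCurves.SelmerGroupCardinality
import Mathlib.GroupTheory.Torsion
import HarnessLib

/-!
# Cell «bsd-uniform», track U2 (2-adic assembly), ROUTE B — `TransportB`:
# Theorem B′ (the `Ш[2]` half) as DESCENT-COUNT BOOKKEEPING from the Selmer transport

HONEST FRAMING (cell «bsd-uniform», HOME `run/shared/lean/pub/bsd-uniform/`, seat u2-p2; PLAN.md §1
row u2-p2 "⇒ Thm B′ (Ш[2])"). What this file IS: the formal step of route T4′'s Theorem B′
(`p2/idea-2/T4-PROOF.md` §6: "By L4, `Sel₂(E^{(M*)}) = Sel₂(E)`, of dimension `r(E) + dim Ш(E)[2] =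
r(E)`; … forcing `rank E^{(M*)} = 1` and `Ш(E^{(M*)})[2] = 0`") that does NOT depend on local
conditions: from
* `hSel : #Sel^(2)(E^{(d)}/ℚ) = #Sel^(2)(E/ℚ)` — the OUTPUT of the Selmer transport L4 (Kramer 1981 /
  Mazur–Rubin 2010 §2 / Kramer–Tunnell 1982 §6 Φ-lemma at every finite place incl. `2`, and the
  archimedean condition `h_∞(d) = 0`; route A's kernel, seat u2-p1; a BINDER here — this is where the
  REDUCTION TYPE AT `2` enters U2: `c_2(E)` odd is needed, RESIDUE otherwise),
* `hT, hT₁ : E(ℚ)[2] = E^{(d)}(ℚ)[2] = 0` ((H-2); `E^{(d)}[2] ≅ E[2]`),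
* `hSha : Ш(E/ℚ)[2] = 0` and `hrk : rank E^{(d)}(ℚ) = rank E(ℚ)` (Theorem A′ for `h_∞ = 0`, sibling
  file `RouteBRankDichotomy` + GZK),
the PROVED descent count `#Sel^(n) = n^{rank} · #E(ℚ)[n] · #Ш[n]` of the tree (stated here over
any number field `K`, where it holds verbatim; over `ℚ` a consumer holding the binders with the
computable `DecidableEq ℚ` rewrites `Subsingleton.elim instDecidableEqRat (Classical.propDecidable _)`
first, as in the tree's `Typed/HigherDescentSelmerCertificate`)
(`card_selmerGroup_eq_pow_rank_mul`, Silverman AEC X.4.2) gives `Ш(E^{(d)}/ℚ)[2] = 0`, and a `2`-group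
with no `2`-torsion is trivial, so `Ш(E^{(d)}/ℚ)[2^∞] = 0` — exactly the binders `hShaA` / `hShaB` of
the sibling file `CorC` (`Nat.card (primaryComponent Ш 2) = 1`). What this file is NOT: it does not
prove the Selmer transport `hSel` (route A), asserts nothing, books nothing.

## Contents (theorems only)
* `primaryComponent_eq_bot_of_forall_smul_eq_zero`, `card_primaryComponent_eq_one_of_forall` —
  no `p`-torsion ⇒ trivial `p`-primary component.
* `card_torsionBy_eq_one_of_forall`, `card_inf_torsionBy_eq_one_of_forall`,
  `forall_of_card_inf_torsionBy_eq_one` — cardinality-one torsion subgroups, elementwise.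
* `sha_two_torsion_trivial_of_selmer_transport` — THEOREM B′ (Ш[2] half) as bookkeeping.
* `card_primaryComponent_sha_two_eq_one_of_selmer_transport` — the `CorC` binder shape
  `#Ш(E^{(d)})[2^∞] = 1`.

References: Silverman AEC X.4.2 [SilvermanAEC2009]; Kramer 1981 Thm. 1 [Kramer1981]; Mazur–Rubin 2010
§2 [MazurRubin2010]; Kriz–Li 2019 Lemma 5.1 / Cor. 5.2 [KrizLi2019]; `p2/idea-2/T4-PROOF.md` v1.9b §6.
-/

noncomputable section

open scoped Classical

open WeierstrassCurve Literature.NumberTheory.EllipticCurves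

namespace Summit.BirchSwinnertonDyer.Uniform.U2

/-! ## No `p`-torsion ⇒ trivial `p`-primary part -/

/-- In an additive commutative group without `p`-torsion the `p`-primary component is trivial:
if `p^k • g = 0` then `g = 0`, by induction on `k`. [folklore] -/
theorem primaryComponent_eq_bot_of_forall_smul_eq_zero {G : Type*} [AddCommGroup G] {p : ℕ}
    (h : ∀ x : G, p • x = 0 → x = 0) :
    AddCommGroup.primaryComponent G p = ⊥ := by
  have key : ∀ (k : ℕ) (g : G), p ^ k • g = 0 → g = 0 := by
    intro k
    induction k with
    | zero => intro g hg; simpa using hg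
    | succ k ih =>
      intro g hg
      apply h
      apply ih
      rw [smul_smul, ← pow_succ]
      exact hg
  rw [eq_bot_iff]
  intro g hg
  obtain ⟨k, hk⟩ := (AddCommGroup.mem_primaryComponent (g := g)).1 hg
  rw [AddSubgroup.mem_bot]
  exact key k g hk

/-- Hence, without `p`-torsion, `#G[p^∞] = 1`. [folklore] -/
theorem card_primaryComponent_eq_one_of_forall {G : Type*} [AddCommGroup G] {p : ℕ}
    (h : ∀ x : G, p • x = 0 → x = 0) :
    Nat.card (AddCommGroup.primaryComponent G p) = 1 := by
  rw [primaryComponent_eq_bot_of_forall_smul_eq_zero h]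
  exact AddSubgroup.card_bot

/-! ## Cardinality-one torsion subgroups, elementwise -/

/-- `#A[n] = 1` when `A` has no `n`-torsion (elementwise hypothesis). [folklore] -/
theorem card_torsionBy_eq_one_of_forall {A : Type*} [AddCommGroup A] (n : ℕ)
    (h : ∀ x : A, n • x = 0 → x = 0) : Nat.card (AddSubgroup.torsionBy A n) = 1 := by
  have hbot : AddSubgroup.torsionBy A n = ⊥ := by
    rw [eq_bot_iff]
    intro x hx
    rw [AddSubgroup.mem_bot]
    exact h x (AddSubgroup.torsionBy.nsmul_iff.1 hx)
  rw [hbot]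
  exact AddSubgroup.card_bot

/-- `#(S ⊓ A[n]) = 1` when `S` has no `n`-torsion (elementwise hypothesis). [folklore] -/
theorem card_inf_torsionBy_eq_one_of_forall {A : Type*} [AddCommGroup A] (S : AddSubgroup A)
    (n : ℕ) (h : ∀ x ∈ S, n • x = 0 → x = 0) :
    Nat.card (S ⊓ AddSubgroup.torsionBy A (n : ℕ) : AddSubgroup A) = 1 := by
  have hbot : (S ⊓ AddSubgroup.torsionBy A (n : ℕ) : AddSubgroup A) = ⊥ := by
    rw [eq_bot_iff]
    intro x hx
    rw [AddSubgroup.mem_bot]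
    obtain ⟨hS, hT⟩ := AddSubgroup.mem_inf.1 hx
    exact h x hS (AddSubgroup.torsionBy.nsmul_iff.1 hT)
  rw [hbot]
  exact AddSubgroup.card_bot

/-- Conversely `#(S ⊓ A[n]) = 1` gives: no `n`-torsion in `S`. [folklore] -/
theorem forall_of_card_inf_torsionBy_eq_one {A : Type*} [AddCommGroup A] (S : AddSubgroup A)
    (n : ℕ) (h : Nat.card (S ⊓ AddSubgroup.torsionBy A (n : ℕ) : AddSubgroup A) = 1)
    (x : A) (hS : x ∈ S) (hx : n • x = 0) : x = 0 := by
  have hbot := AddSubgroup.eq_bot_of_card_eq _ h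
  have hmem : x ∈ (S ⊓ AddSubgroup.torsionBy A (n : ℕ) : AddSubgroup A) :=
    AddSubgroup.mem_inf.2 ⟨hS, AddSubgroup.torsionBy.nsmul_iff.2 hx⟩
  rw [hbot, AddSubgroup.mem_bot] at hmem
  exact hmem

/-! ## Theorem B′ (the `Ш[2]` half) as descent-count bookkeeping -/

/-- **THEOREM B′, `Ш[2]` half, from the Selmer transport (route T4′ §6).** For elliptic `W ≅ E`,
`W₁ ≅ E^{(d)}` over `ℚ`: if `#Sel^(2)(W₁) = #Sel^(2)(W)` (`hSel`, the Selmer transport L4 — binder;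
route A), `E(ℚ)[2] = E^{(d)}(ℚ)[2] = 0` (`hT`, `hT₁`, elementwise), `Ш(E)[2] = 0` (`hSha`,
elementwise on the subgroup `Ш ≤ H¹(ℚ, E)`) and `rank E^{(d)} = rank E` (`hrk`, Theorem A′ with
`h_∞(d) = 0`), then `Ш(E^{(d)})[2] = 0` — by the descent count
`#Sel^(2) = 2^{rank} · #E(ℚ)[2] · #Ш[2]` (tree theorem `card_selmerGroup_eq_pow_rank_mul`,
Silverman AEC X.4.2) on both sides. [cite: SilvermanAEC2009, Thm X.4.2(a)]
[cite: KrizLi2019, Lemma 5.1 (1)-(2) with Cor. 5.2 (the split-prime instance)] -/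
theorem sha_two_torsion_trivial_of_selmer_transport {K : Type*} [Field K] [NumberField K]
    (W W₁ : WeierstrassCurve K) [W.IsElliptic] [W₁.IsElliptic]
    (hSel : Nat.card (W₁.selmerGroup ((2 : ℕ) : ℤ)) = Nat.card (W.selmerGroup ((2 : ℕ) : ℤ)))
    (hT : ∀ P : W.toAffine.Point, 2 • P = 0 → P = 0)
    (hT₁ : ∀ P : W₁.toAffine.Point, 2 • P = 0 → P = 0)
    (hSha : ∀ x : W.galH1, x ∈ W.sha → 2 • x = 0 → x = 0)
    (hrk : W₁.mordellWeilRank = W.mordellWeilRank) :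
    ∀ x : W₁.galH1, x ∈ W₁.sha → 2 • x = 0 → x = 0 := by
  have h := card_selmerGroup_eq_pow_rank_mul W 2
  have h₁ := card_selmerGroup_eq_pow_rank_mul W₁ 2
  rw [card_torsionBy_eq_one_of_forall 2 hT, card_inf_torsionBy_eq_one_of_forall W.sha 2 hSha,
    mul_one, mul_one] at h
  rw [card_torsionBy_eq_one_of_forall 2 hT₁, mul_one, hrk, hSel, h] at h₁
  -- `h₁ : 2^r = 2^r * #Ш(W₁)[2]`
  have hpos : 0 < 2 ^ W.mordellWeilRank := by positivity
  have h2 : 2 ^ W.mordellWeilRank * 1 =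
      2 ^ W.mordellWeilRank *
        Nat.card (W₁.sha ⊓ AddSubgroup.torsionBy W₁.galH1 (2 : ℕ) : AddSubgroup W₁.galH1) := by
    rw [mul_one]; exact h₁
  exact forall_of_card_inf_torsionBy_eq_one W₁.sha 2 (Nat.eq_of_mul_eq_mul_left hpos h2).symm

/-- **The `CorC` binder shape**: under the hypotheses of
`sha_two_torsion_trivial_of_selmer_transport`, `#Ш(E^{(d)}/ℚ)[2^∞] = 1` (a `2`-group without
`2`-torsion is trivial). [cite: SilvermanAEC2009, Thm X.4.2(a)] -/
theorem card_primaryComponent_sha_two_eq_one_of_selmer_transport {K : Type*} [Field K]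
    [NumberField K] (W W₁ : WeierstrassCurve K) [W.IsElliptic] [W₁.IsElliptic]
    (hSel : Nat.card (W₁.selmerGroup ((2 : ℕ) : ℤ)) = Nat.card (W.selmerGroup ((2 : ℕ) : ℤ)))
    (hT : ∀ P : W.toAffine.Point, 2 • P = 0 → P = 0)
    (hT₁ : ∀ P : W₁.toAffine.Point, 2 • P = 0 → P = 0)
    (hSha : ∀ x : W.galH1, x ∈ W.sha → 2 • x = 0 → x = 0)
    (hrk : W₁.mordellWeilRank = W.mordellWeilRank) :
    Nat.card (AddCommGroup.primaryComponent W₁.sha 2) = 1 :=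
  card_primaryComponent_eq_one_of_forall (fun x hx =>
    Subtype.ext (sha_two_torsion_trivial_of_selmer_transport W W₁ hSel hT hT₁ hSha hrk x x.2
      (by exact_mod_cast congrArg Subtype.val hx)))

end Summit.BirchSwinnertonDyer.Uniform.U2

end
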